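import Summits.CriticalPhenomena.CardyFormulaZ2.Theses.CardySelfDualSegment
import Summits.CriticalPhenomena.CardyFormulaZ2.Theorems.CardySelfDualSegmentUniformBoxCrossingOfMonotoneChirality
import Summits.CriticalPhenomena.CardyFormulaZ2.Theorems.CardySelfDualSegmentUniformBoxCrossingStubBinomial
import Summits.CriticalPhenomena.CardyFormulaZ2.Theorems.CardySelfDualSegmentUniformBoxCrossingStubTilt
import Summits.CriticalPhenomena.CardyFormulaZ2.Theorems.CardySelfDualSegmentUniformBoxCrossingStubLocal
import Summits.CriticalPhenomena.CardyFormulaZ2.Theorems.CardySelfDualSegmentUniformBoxCrossingOfMicrocanonical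
import HarnessLib

/-!
# `UniformBoxCrossing` (stmt-CriticalPhenomena-5476) — skeleton of line `Sketch`, RESHAPED v4.1
# (continuation lead c6, 2026-08-17): the MICROCANONICAL composition

The crux (t-uniform box-crossing bounds for the corner family `M_t = cornerPercolation t`,
`t ∈ [0,1]`) follows from ENDPOINT DOMINATION of the 45°-turned 2:1 boxes (v3, lead c4/c5:
`P_0(U) ≤ P_t(U)` for u-crossings of the turned `m × 2m` boxes, `P_1(W) ≤ P_t(W)` for
w-crossings of the turned `2m × m` boxes) through the landed chain
`uniformBoxCrossing_of_endpointDomination` (p139614). Version 4 derives the two endpoint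
dominations from statements about ONE measure — critical bond percolation `M_1 = P_{1/2}` on `ℤ²`
(`cornerPercolation_one`) — by the exact TILT IDENTITY of the family (KERNEL-DOSSIER-c4 §1 /
c5 §2.1, here a registered provable stub): for an event `E` of a finite box with corner set `F`,

  `P_t(E) = 2^{|F|} Σ_k (t/2)^k (1 - t/2)^{|F|-k} · P_1(E ∩ {exactly k corners of F disagree})`,

a corner `v` DISAGREEING in `ω` when exactly one of its two edges `{v, v+e₁}`, `{v, v+e₂}` is open
(in coin space: the splitting bit `(v,1)` is on; `M_t` and `M_1` differ only in the bias `t/2`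
versus `1/2` of the splitting bits). Writing `N_k := 2^{|F|} P_1(E ∩ {k disagree})` and
`φ̄_k := N_k / C(|F|,k)` (the MICROCANONICAL PROFILE: the probability of `E` given that exactly `k`
uniformly placed corners disagree), `P_t(E) = E_{K ∼ Bin(|F|, t/2)} φ̄_K`. Hence:

* `stub_microcanonicalU` (research, single measure): `k ↦ φ̄_k(U)` is non-decreasing for the
  turned `m × 2m` u-boxes, eventually in `m` ⇒ `P_t(U) ≥ φ̄_0 = P_0(U)` (= ED-U);
* `stub_microcanonicalW` (research, single measure): `k ↦ φ̄_k(W)` is non-increasing for the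
  turned `2m × m` w-boxes ⇒ `s ↦ E_{Bin(|F|,s)} φ̄_K` is non-increasing on `[0,1]`, so
  `P_t(W) = (value at s = t/2 ≤ 1/2) ≥ (value at 1/2) = P_1(W)` (= ED-W);

both by the pure binomial-mixture lemma `stub_binomial` and the locality of the two crossing
events `stub_local` (they are cylinder events over the coins of the finitely many vertices of
their regions). The microcanonical monotonicity is c5's form (iii) ("among all bond
configurations of the box with exactly `k` NE-corners in disagreement, the fraction with a hard-way
u-crossing grows with `k`, the fraction with a hard-way w-crossing decreases"): EXACT for `m ≤ 3`
(strictly monotone profiles, c4 §2b / c5 §1.2), it implies monotone chirality MC₂ on the whole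
extended family `t ∈ [0,2]` (Bernstein shape preservation) and hence endpoint domination; the
corner set `F` used here is the full vertex set of the event's region (extra, inessential corners
only smooth the profile hypergeometrically, which preserves monotonicity — so this is the weakest
form of the family between "essential corners only" and the canonical MC₂).

Stubs: `stub_binomial`, `stub_tilt`, `stub_local` (provable — LANDED p155271/p156036/p156413);
`stub_microcanonicalU`, `stub_microcanonicalW` (research kernel, single-measure; the only `sorry`s). Glue: `endpointDominationU`,
`endpointDominationW` (the v3 stubs, now theorems), `endpointDomination_of_halves`,
`UniformBoxCrossing_of` (crux by name via p139614). v3 (endpoint halves as stubs) is kept in the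
lead folder as `work/v3/UniformBoxCrossing.v3-endpoint-halves.lean`; the planners' split package
(SPLIT-EndpointDomination.md, children = ED-U / ED-W) is unaffected: this skeleton proves both
children from the microcanonical stubs.
-/

namespace Summit.CriticalPhenomena.CardyFormulaZ2.Cruxes.UniformBoxCrossing.Microcanonical

open MeasureTheory Complex Literature.Probability.Percolation Literature.Probability.LatticeModels
open Literature.Probability.Percolation.TrackExchange
open Summit.CriticalPhenomena.CardyFormulaZ2.Theses.CardySelfDualSegment
open Summit.CriticalPhenomena.CardyFormulaZ2.Cruxes.UniformBoxCrossing.NonSlantLine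

/-! ### Provable stubs — ALL LANDED (wave 1, lead c6)

`stub_binomial` (binomial mixtures of monotone profiles) — p155271,
`Theorems/CardySelfDualSegmentUniformBoxCrossingStubBinomial.lean`;
`stub_tilt` (the tilt identity `P_t(E) = 2^{|F|} Σ_k (t/2)^k (1-t/2)^{|F|-k} P_1(E ∩ {k disagree})`)
— p156036, `Theorems/CardySelfDualSegmentUniformBoxCrossingStubTilt.lean`;
`stub_local` (finiteness / measurability / coin-locality of the turned crossing events) — p156413,
`Theorems/CardySelfDualSegmentUniformBoxCrossingStubLocal.lean`. Imported above; used below by name. -/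

/-! ### Research stubs (the kernel, single-measure form) -/

/-- **Stub D (research): microcanonical monotonicity, u-half.** In critical bond percolation
`M_1 = P_{1/2}` on `ℤ²`, for the hard-way u-crossing `U` of the turned `m × 2m` box at `(A,B)`
with vertex set `F`, the microcanonical profile `φ̄_k(U) = P_1(U | exactly k corners of F
disagree)` is non-decreasing in `k`, eventually in `m` (cross-multiplied form, no division):
"anti-tying one more uniformly placed corner never lowers hard-way u-crossings on average".
Exact for `m ≤ 3` (strict); implies monotone chirality for `U` on the whole extended family and
`P_t(U) ≥ P_0(U)`. -/
theorem stub_microcanonicalU :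
    ∃ m₁ : ℕ, ∀ m : ℕ, m₁ ≤ m → ∀ (A B : ℤ) (F : Finset (Site 2)),
      (↑F = {v : Site 2 | A ≤ col v ∧ col v ≤ A + m ∧ B - 2 ≤ hgtOf v ∧ hgtOf v ≤ B + 2 * m + 2}) →
      ∀ k : ℕ, k + 1 ≤ F.card →
        2 ^ F.card * (cornerPercolation 1).real
            (embTBCrossing (fun v => zDia v - ((A : ℂ) + (B : ℂ) * I)) m (2 * m) ∩
              {ω | Set.ncard {v : Site 2 | v ∈ (↑F : Set (Site 2)) ∧
                Xor (cornerEdge (v, 0) ∈ ω) (cornerEdge (v, 1) ∈ ω)} = k}) *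
          (F.card.choose (k + 1) : ℝ) ≤
        2 ^ F.card * (cornerPercolation 1).real
            (embTBCrossing (fun v => zDia v - ((A : ℂ) + (B : ℂ) * I)) m (2 * m) ∩
              {ω | Set.ncard {v : Site 2 | v ∈ (↑F : Set (Site 2)) ∧
                Xor (cornerEdge (v, 0) ∈ ω) (cornerEdge (v, 1) ∈ ω)} = k + 1}) *
          (F.card.choose k : ℝ) := by
  sorry

/-- **Stub E (research): microcanonical monotonicity, w-half.** In critical bond percolation
`M_1 = P_{1/2}` on `ℤ²`, for the hard-way w-crossing `W` of the turned `2m × m` box at `(A,B)`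
with vertex set `F`, the microcanonical profile `φ̄_k(W)` is non-increasing in `k`, eventually in
`m`: "anti-tying one more uniformly placed corner never raises hard-way w-crossings on average".
Exact for `m ≤ 3`; implies monotone chirality for `W` and `P_t(W) ≥ P_1(W)` for `t ≤ 1`. -/
theorem stub_microcanonicalW :
    ∃ m₁ : ℕ, ∀ m : ℕ, m₁ ≤ m → ∀ (A B : ℤ) (F : Finset (Site 2)),
      (↑F = {v : Site 2 | A - 2 ≤ col v ∧ col v ≤ A + 2 * m + 2 ∧ B ≤ hgtOf v ∧ hgtOf v ≤ B + m}) →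
      ∀ k : ℕ, k + 1 ≤ F.card →
        2 ^ F.card * (cornerPercolation 1).real
            (embRectCrossing (fun v => zDia v - ((A : ℂ) + (B : ℂ) * I)) (2 * m) m ∩
              {ω | Set.ncard {v : Site 2 | v ∈ (↑F : Set (Site 2)) ∧
                Xor (cornerEdge (v, 0) ∈ ω) (cornerEdge (v, 1) ∈ ω)} = k + 1}) *
          (F.card.choose k : ℝ) ≤
        2 ^ F.card * (cornerPercolation 1).real
            (embRectCrossing (fun v => zDia v - ((A : ℂ) + (B : ℂ) * I)) (2 * m) m ∩
              {ω | Set.ncard {v : Site 2 | v ∈ (↑F : Set (Site 2)) ∧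
                Xor (cornerEdge (v, 0) ∈ ω) (cornerEdge (v, 1) ∈ ω)} = k}) *
          (F.card.choose (k + 1) : ℝ) := by
  sorry

/-! ### The crux from the stubs -/

/-- **The crux from the stubs**: `UniformBoxCrossing`, by the landed conditional composition of
line `Sketch` v4 (`uniformBoxCrossing_of_microcanonical`: MM ⇒ endpoint domination by the tilt
identity and the binomial-mixture lemma, then `uniformBoxCrossing_of_endpointDomination`, p139614)
applied to the two microcanonical stubs. -/
theorem UniformBoxCrossing_of : UniformBoxCrossing :=
  uniformBoxCrossing_of_microcanonical stub_microcanonicalU stub_microcanonicalW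

end Summit.CriticalPhenomena.CardyFormulaZ2.Cruxes.UniformBoxCrossing.Microcanonical
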